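import Mathlib
import Summits.Ventures.PercRepro2.WeightedRowInactiveMin

/-!
# The mixed BHK slack dominates the smaller diagonal slack: the candidate `MinRowBHK` and
`QuantMixedBHK` from it
(blind cell PercRepro2, night-3 g22, 2026-08-28; `proofs/NIGHT3-CERT.md` §31.7)

Along the edge line of `e` the BHK06 Thm 1.4 slack `Φ(p) = P(Q,bL)P(Q,oH) + P(Q,bH)P(Q,oL) −
P(Q)P(Q,opp)` is the quadratic `(1 − p_e)²·Φ₀₀ + p_e²·Φ₁₁ + p_e(1 − p_e)·M` in `p_e`, with `Φ_ss` the
slack of the pinned law `p[e := s]` (`bhkSlack`) and `M = Φ₀₁ + Φ₁₀` the mixed slack (`mixedSlack`,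
the right side minus the left side of g20's `MixedBHK`).

* **`MinRowBHK`** (CANDIDATE, a `def`, NOT claimed proved): `min(Φ₀₀, Φ₁₁) ≤ M` at every edge `e` of
  every product law — the middle Bernstein coefficient of the BHK slack along an edge line dominates
  the smaller endpoint coefficient.  Census (night-3 g22, exact rationals, mphi_test*.py): 0 failures
  on 8,811 edge-instances (n ≤ 7, m ≤ 9, distinct and coincident marks, weights incl. 0/1); by edge
  class: `M ≥ Φ₁₁` on all 5,294 edges touching `a₁` or `a₂` (g21's root-edge row, `Φ₁₁ ≤ M`), `M ≥ Φ₀₀`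
  on all 2,658 edges touching `o` or `b` and on 872 / 873 edges with both ends unmarked (the one
  failure has `M ≥ Φ₁₁`), while `M ≥ Φ₀₀` fails at 85 root edges and `M ≥ Φ₁₁` at 60 `o`/`b`-edges.
* **`quantMixedBHK_of_minRowBHK`**: `MinRowBHK → QuantMixedBHK` (g20's candidate
  `q₀·M ≥ (q₀ − q₁)·min(Φ₀₀, Φ₁₁)`): with `q₁ ≤ q₀` (`Q` decreasing) and `min(Φ₀₀, Φ₁₁) ≥ 0` (BHK 1.4
  for both pinned laws), `q₀·M ≥ q₀·min ≥ (q₀ − q₁)·min`.  Hence, through g20's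
  `wrowMin_of_a3Inactive_of_quantMixedBHK`, the weighted row (W-ROW-MIN) holds at EVERY edge of every
  `a₃`-inactive instance modulo `MinRowBHK` alone (`wrowMin_of_a3Inactive_of_minRowBHK`).
  At a root edge `g = {a₁, v}`, `Φ₁₁ ≤ M` is g21's row, forced by (3M) (`Phi11_le_M_of_threeMark`).

Own work; standard axioms.
-/

namespace Summit.Ventures.PercRepro2

open UnionCluster

namespace CovForm

section MinRow

open A3Inactive

variable {V : Type*} {E : Type*} [Fintype E] [DecidableEq E] [Fintype V] [DecidableEq V]
  {R : Type*} [Field R] [LinearOrder R] [IsStrictOrderedRing R]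

/-- The BHK06 Thm 1.4 slack of a product law (both halves):
`Φ = [P(Q,bL)P(Q,oH) − P(Q)P(Q,oH,bL)] + [P(Q,bH)P(Q,oL) − P(Q)P(Q,oL,bH)]`. -/
noncomputable def bhkSlack (p : E → R) (ends : E → Sym2 V) (o a₁ a₂ b : V) : R :=
  (prob p (avoidAll ends a₂ {a₁} ∩ connEvent ends a₁ b) *
      prob p (avoidAll ends a₂ {a₁} ∩ connEvent ends a₂ o) -
    prob p (avoidAll ends a₂ {a₁}) *
      prob p (avoidAll ends a₂ {a₁} ∩ (connEvent ends a₂ o ∩ connEvent ends a₁ b))) +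
  (prob p (avoidAll ends a₂ {a₁} ∩ connEvent ends a₂ b) *
      prob p (avoidAll ends a₂ {a₁} ∩ connEvent ends a₁ o) -
    prob p (avoidAll ends a₂ {a₁}) *
      prob p (avoidAll ends a₂ {a₁} ∩ (connEvent ends a₁ o ∩ connEvent ends a₂ b)))

/-- The mixed BHK slack `M = Φ₀₁ + Φ₁₀` of the two pinned laws `p[e := 0]`, `p[e := 1]` at `e`. -/
noncomputable def mixedSlack (p : E → R) (ends : E → Sym2 V) (o a₁ a₂ b : V) (e : E) : R :=
  (prob (Function.update p e 0) (avoidAll ends a₂ {a₁} ∩ connEvent ends a₁ b) *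
        prob (Function.update p e 1) (avoidAll ends a₂ {a₁} ∩ connEvent ends a₂ o) +
      prob (Function.update p e 1) (avoidAll ends a₂ {a₁} ∩ connEvent ends a₁ b) *
        prob (Function.update p e 0) (avoidAll ends a₂ {a₁} ∩ connEvent ends a₂ o) +
      prob (Function.update p e 0) (avoidAll ends a₂ {a₁} ∩ connEvent ends a₂ b) *
        prob (Function.update p e 1) (avoidAll ends a₂ {a₁} ∩ connEvent ends a₁ o) +
      prob (Function.update p e 1) (avoidAll ends a₂ {a₁} ∩ connEvent ends a₂ b) *
        prob (Function.update p e 0) (avoidAll ends a₂ {a₁} ∩ connEvent ends a₁ o)) -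
    (prob (Function.update p e 0) (avoidAll ends a₂ {a₁}) *
        prob (Function.update p e 1)
          (avoidAll ends a₂ {a₁} ∩ (connEvent ends a₂ o ∩ connEvent ends a₁ b)) +
      prob (Function.update p e 1) (avoidAll ends a₂ {a₁}) *
        prob (Function.update p e 0)
          (avoidAll ends a₂ {a₁} ∩ (connEvent ends a₂ o ∩ connEvent ends a₁ b)) +
      prob (Function.update p e 0) (avoidAll ends a₂ {a₁}) *
        prob (Function.update p e 1)
          (avoidAll ends a₂ {a₁} ∩ (connEvent ends a₁ o ∩ connEvent ends a₂ b)) +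
      prob (Function.update p e 1) (avoidAll ends a₂ {a₁}) *
        prob (Function.update p e 0)
          (avoidAll ends a₂ {a₁} ∩ (connEvent ends a₁ o ∩ connEvent ends a₂ b)))

/-- **`MinRowBHK`, a CANDIDATE (NOT claimed proved)**: at every edge of every product law the mixed
BHK slack dominates the smaller of the two pinned slacks, `min(Φ₀₀, Φ₁₁) ≤ M`.  Census (night-3
g22, exact): 0 / 8,811 edge-instances; by class `Φ₁₁ ≤ M` at root edges (0 / 5,294) and `Φ₀₀ ≤ M`
at `o`/`b`-edges (0 / 2,658). -/
def MinRowBHK (ends : E → Sym2 V) (o a₁ a₂ b : V) : Prop :=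
  ∀ (p : E → R), IsProbVec p → ∀ e : E,
    min (bhkSlack (Function.update p e 0) ends o a₁ a₂ b)
        (bhkSlack (Function.update p e 1) ends o a₁ a₂ b) ≤
      mixedSlack p ends o a₁ a₂ b e

/-- The BHK slack is nonnegative (BHK06 Thm 1.4 for both halves). -/
lemma bhkSlack_nonneg (p : E → R) (hp : IsProbVec p) (ends : E → Sym2 V) (o a₁ a₂ b : V) :
    0 ≤ bhkSlack p ends o a₁ a₂ b := by
  unfold bhkSlack
  have h1 := bLoH_mul_Q_le p hp ends o a₁ a₂ b
  have h2 := bHoL_mul_Q_le p hp ends o a₁ a₂ b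
  linarith [h1, h2]

/-- **`MinRowBHK → QuantMixedBHK`**: `q₀·M ≥ q₀·min(Φ₀₀, Φ₁₁) ≥ (q₀ − q₁)·min(Φ₀₀, Φ₁₁)`. -/
theorem quantMixedBHK_of_minRowBHK {ends : E → Sym2 V} {o a₁ a₂ b : V}
    (h : MinRowBHK (R := R) ends o a₁ a₂ b) : QuantMixedBHK (R := R) ends o a₁ a₂ b := by
  intro p hp e
  have hm := h p hp e
  have hq := prob_Q_update_one_le p hp ends a₁ a₂ e
  have hp0 : IsProbVec (Function.update p e 0) := hp.update e le_rfl zero_le_one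
  have hp1 : IsProbVec (Function.update p e 1) := hp.update e zero_le_one le_rfl
  have h0 := bhkSlack_nonneg (Function.update p e 0) hp0 ends o a₁ a₂ b
  have h1 := bhkSlack_nonneg (Function.update p e 1) hp1 ends o a₁ a₂ b
  have hQ0 := prob_nonneg hp0 (avoidAll ends a₂ {a₁})
  have hQ1 := prob_nonneg hp1 (avoidAll ends a₂ {a₁})
  have hmin0 : 0 ≤ min (bhkSlack (Function.update p e 0) ends o a₁ a₂ b)
      (bhkSlack (Function.update p e 1) ends o a₁ a₂ b) := le_min h0 h1
  have key1 := mul_le_mul_of_nonneg_left hm hQ0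
  have key2 := mul_nonneg hQ1 hmin0
  unfold bhkSlack mixedSlack at key1
  unfold bhkSlack at key2 hmin0
  -- `(q₀ − q₁)·min ≤ q₀·M` from `q₀·min ≤ q₀·M` and `0 ≤ q₁·min`
  set q0 := prob (Function.update p e 0) (avoidAll ends a₂ {a₁}) with hq0
  set q1 := prob (Function.update p e 1) (avoidAll ends a₂ {a₁}) with hq1
  nlinarith [key1, key2]

/-- **The weighted row (W-ROW-MIN) at every edge of an `a₃`-inactive instance ⟸ `MinRowBHK`**
(g20's `wrowMin_of_a3Inactive_of_quantMixedBHK` with `QuantMixedBHK` discharged). -/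
theorem wrowMin_of_a3Inactive_of_minRowBHK (ends : E → Sym2 V) (o a₁ a₂ a₃ b : V)
    (hm : MinRowBHK (R := R) ends o a₁ a₂ b)
    (h : ∀ ω : Config E, ¬ Conn ends ω a₁ a₃ ∧ ¬ Conn ends ω a₂ a₃)
    (p : E → R) (hp : IsProbVec p) (e : E) (τ : E → ℕ) (hτ : τ e = 1) :
    p e * (1 - p e) ^ 2 * Gc (Function.update p e 0) ends o a₁ a₂ a₃ b ≤
        triSum p {e} τ (K3 ends o a₁ a₂ a₃ b) ∨
      p e * (1 - p e) ^ 2 * Gc (Function.update p e 1) ends o a₁ a₂ a₃ b ≤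
        triSum p {e} τ (K3 ends o a₁ a₂ a₃ b) :=
  wrowMin_of_a3Inactive_of_quantMixedBHK ends o a₁ a₂ a₃ b (quantMixedBHK_of_minRowBHK hm) h p hp
    e τ hτ

end MinRow

end CovForm

end Summit.Ventures.PercRepro2
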